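import Summits.Ventures.DiscreteObjects.Hadamard.Order25FixedNotThree668
import Summits.Ventures.DiscreteObjects.Hadamard.Order49Excluded668
import Summits.Ventures.DiscreteObjects.Hadamard.FreeOrbits

/-!
# Hadamard 668 census, family F12 — an automorphism of order 25 of an H(668): its 5th power fixes EXACTLY 68 rows and
# 68 columns (kernel, structure; the case 18 is excluded)

Framing: lottery ticket; floor = certified bounds/negative ranges.

Cell pub-namedobj (venture DiscreteObjects), target (H), hadamard gen 18.  Gen 17 (`PrimeSquareStructure668`) left, for
a signed automorphism `(π, κ, d, e)` of an H(668) of pair-order `25`, the fifth powers fixing `18` or `68` rows /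
columns.  The fixed Gram matrix removes `18`:
* `dvd_sum_of_free`: a `κ`-invariant integer function summed over a `κ`-stable finset on which `κ` (with `κ^n = 1`)
  acts freely is divisible by `n` (orbit by orbit, `sum_orbFin_of_invariant`; the sum version of `dvd_card_of_free`);
  `sq_dvd_sum_moved_pow`: hence for `κ^(p·p) = 1`, **`p² ∣ Σ_{κ^p y ≠ y} g(y)`** for `κ`-invariant `g`
  (the points moved by `κ^p` are free below `p²`, `free_of_moved_pow`).
* **`hadamard668_order25_pow5_fixed`**: `π^25 = κ^25 = 1`, `(π⁵, κ⁵) ≠ (1,1)` ⇒ `#Fix(π⁵) = #Fix(κ⁵) = 68`.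
  PROOF.  Suppose `#Fix(κ⁵) = 18`.  `π` fixes at least `3` rows and `κ` at least one column (gen 17), and all
  `π`-fixed rows carry the sign of a `κ`-fixed column; for two distinct `π`-fixed rows `x ≠ x'` the function
  `y ↦ H x y · H x' y` is `κ`-invariant and sums to `0` (orthogonality), its sum over the columns MOVED by `κ⁵` is
  divisible by `25`, so its sum over the `18` columns FIXED by `κ⁵` is a multiple of `25` of absolute value `≤ 18`,
  i.e. `0`.  Three distinct `π`-fixed rows restricted to `Fix(κ⁵)` are then pairwise-orthogonal `±1` vectors of
  length `18`, contradicting `four_dvd_card_of_three_orth` (`4 ∤ 18`).  Rows by transposition.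
With `FixedGramModP` (`#Fix π = #Fix κ ∈ {8, 18}`) the order-`25` structure is now: 5th powers fix exactly `68 + 68`,
the element `8 + 8` or `18 + 18`.  STRUCTURE only: order `25` is not excluded.  Ours, not literature; no `sorry`, no
definitions, default heartbeats.
-/

namespace Summit.Ventures.DiscreteObjects.Hadamard

open Finset BigOperators Matrix

open Literature.Combinatorics.Designs.GoethalsSeidel (IsHadamardMatrix)

variable {ι : Type*} [Fintype ι] [DecidableEq ι]

omit [Fintype ι] in
/-- **Orbit sums of a free action.**  If `κ^n = 1`, `Y` is `κ`-stable, every point of `Y` is free below `n`, and `g`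
is `κ`-invariant, then `n ∣ Σ_{y ∈ Y} g(y)`. -/
lemma dvd_sum_of_free (κ : Equiv.Perm ι) {n : ℕ} (hn : 0 < n) (hκ : κ ^ n = 1) (g : ι → ℤ)
    (hg : ∀ y, g (κ y) = g y) :
    ∀ (N : ℕ) (Y : Finset ι), Y.card ≤ N → (∀ y ∈ Y, κ y ∈ Y) →
      (∀ y ∈ Y, ∀ k, 0 < k → k < n → (κ ^ k) y ≠ y) → (n : ℤ) ∣ ∑ y ∈ Y, g y := by
  intro N
  induction N with
  | zero =>
    intro Y hY _ _
    rw [Finset.card_eq_zero.mp (Nat.le_zero.mp hY), Finset.sum_empty]; exact dvd_zero _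
  | succ N ih =>
    intro Y hY hstab hfree
    rcases Y.eq_empty_or_nonempty with hYe | ⟨y, hy⟩
    · rw [hYe, Finset.sum_empty]; exact dvd_zero _
    · have hO : orbFin κ n y ⊆ Y := orbFin_subset_of_stable Y hstab hy
      have hOc : (orbFin κ n y).card = n := card_orbFin_of_free (hfree y hy)
      have hcard : (Y \ orbFin κ n y).card + n = Y.card := by
        have h := Finset.card_sdiff_add_card_eq_card hO
        rw [hOc] at h
        exact h
      have hstab' : ∀ z ∈ Y \ orbFin κ n y, κ z ∈ Y \ orbFin κ n y := by
        intro z hz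
        rw [Finset.mem_sdiff] at hz ⊢
        refine ⟨hstab z hz.1, fun hκz => hz.2 ?_⟩
        have e : z = (κ ^ (n - 1)) (κ z) := by
          rw [← Equiv.Perm.mul_apply, ← pow_succ, Nat.sub_add_cancel hn, hκ]; rfl
        rw [e]
        obtain ⟨i, -, hi⟩ := Finset.mem_image.mp hκz
        rw [← hi, ← Equiv.Perm.mul_apply, ← pow_add]
        exact pow_apply_mem_orbFin κ hn hκ y _
      have hfree' : ∀ z ∈ Y \ orbFin κ n y, ∀ k, 0 < k → k < n → (κ ^ k) z ≠ z :=
        fun z hz => hfree z (Finset.mem_sdiff.mp hz).1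
      have hlt : (Y \ orbFin κ n y).card ≤ N := by omega
      have hrest := ih (Y \ orbFin κ n y) hlt hstab' hfree'
      rw [← Finset.sum_sdiff hO]
      apply dvd_add hrest
      rw [sum_orbFin_of_invariant (hfree y hy) g hg]
      exact dvd_mul_right _ _

/-- **`p² ∣ Σ_{κ^p y ≠ y} g(y)`** for `κ^(p·p) = 1` (`p` prime) and `κ`-invariant `g`. -/
theorem sq_dvd_sum_moved_pow (κ : Equiv.Perm ι) {p : ℕ} (hp : p.Prime) (hκ : κ ^ (p * p) = 1) (g : ι → ℤ)
    (hg : ∀ y, g (κ y) = g y) :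
    ((p * p : ℕ) : ℤ) ∣ ∑ y ∈ univ.filter (fun y => (κ ^ p) y ≠ y), g y := by
  apply dvd_sum_of_free κ (Nat.mul_pos hp.pos hp.pos) hκ g hg _ _ le_rfl
  · intro y hy
    simp only [Finset.mem_filter, Finset.mem_univ, true_and] at hy ⊢
    rw [pow_apply_comm κ p y]
    exact fun h => hy (κ.injective h)
  · intro y hy
    simp only [Finset.mem_filter, Finset.mem_univ, true_and] at hy
    exact free_of_moved_pow κ hp hκ hy

section main
variable {H : Matrix ι ι ℤ}

/-- columns: `#Fix(κ⁵) = 18` is impossible for an automorphism of pair-order `25` of an H(668) -/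
lemma order25_pow5_cols (hH : IsHadamardMatrix H) (hι : Fintype.card ι = 668)
    {π κ : Equiv.Perm ι} {d e : ι → ℤ} (haut : IsSignedAut H π κ d e)
    (hπ : π ^ 25 = 1) (hκ : κ ^ 25 = 1) (hne : π ^ 5 ≠ 1 ∨ κ ^ 5 ≠ 1) :
    (univ.filter fun j => (κ ^ 5) j = j).card = 68 := by
  obtain ⟨-, hC5, hR, hC, -, -⟩ := hadamard668_order25_structure hH hι π κ d e haut hπ hκ hne
  rcases hC5 with h18 | h68
  · exfalso
    -- three distinct π-fixed rows and one κ-fixed column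
    have h2 : 2 < (univ.filter fun i => π i = i).card := by omega
    obtain ⟨x₁, hx₁, x₂, hx₂, x₃, hx₃, h12, h13, h23⟩ := Finset.two_lt_card.mp h2
    simp only [Finset.mem_filter, Finset.mem_univ, true_and] at hx₁ hx₂ hx₃
    have h0 : 0 < (univ.filter fun j => κ j = j).card := by omega
    obtain ⟨j₀, hj₀⟩ := Finset.card_pos.mp h0
    simp only [Finset.mem_filter, Finset.mem_univ, true_and] at hj₀
    have hd : ∀ x, π x = x → d x = e j₀ := fun x hx => signedAut_fixed_sign hH.1 haut hx hj₀
    have hκ' : κ ^ (5 * 5) = 1 := hκ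
    -- distinct fixed rows are orthogonal on Fix(κ⁵)
    have hS : ∀ x x', x ≠ x' → π x = x → π x' = x' →
        ∑ y ∈ univ.filter (fun j => (κ ^ 5) j = j), H x y * H x' y = 0 := by
      intro x x' hxx' hx hx'
      have horth : ∑ y, H x y * H x' y = 0 := hadamard_row_orth H hH hxx'
      have hsplit := Finset.sum_filter_add_sum_filter_not (univ : Finset ι) (fun j => (κ ^ 5) j = j)
        (fun y => H x y * H x' y)
      rw [horth] at hsplit
      have hinv : ∀ y, H x (κ y) * H x' (κ y) = H x y * H x' y := by
        intro y
        have h1 := haut.2.2 x y; have h2' := haut.2.2 x' y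
        rw [hx] at h1; rw [hx'] at h2'
        rw [h1, h2', hd x hx, hd x' hx']
        have hd2 : e j₀ * e j₀ = 1 := pm_mul_self (haut.2.1 j₀)
        have he2 : e y * e y = 1 := pm_mul_self (haut.2.1 y)
        calc e j₀ * e y * H x y * (e j₀ * e y * H x' y) = (e j₀ * e j₀) * (e y * e y) * (H x y * H x' y) := by ring
          _ = H x y * H x' y := by rw [hd2, he2, one_mul, one_mul]
      have hT := sq_dvd_sum_moved_pow κ (by norm_num : (5 : ℕ).Prime) hκ' (fun y => H x y * H x' y) hinv
      have e1 : (univ.filter fun j => ¬ (κ ^ 5) j = j) = univ.filter fun j => (κ ^ 5) j ≠ j := rfl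
      rw [e1] at hsplit
      obtain ⟨m, hm, hsum⟩ := sum_pm_eq_card_sub_two_mul (univ.filter fun j => (κ ^ 5) j = j)
        (fun y => H x y * H x' y)
        (fun y _ => by rcases hH.1 x y with h1 | h1 <;> rcases hH.1 x' y with h2 | h2 <;> simp [h1, h2])
      rw [hsum] at hsplit ⊢
      rw [h18] at hm hsplit ⊢
      obtain ⟨c, hc⟩ := hT
      push_cast at hc hsplit ⊢
      omega
    have hpm : ∀ x, ∀ y ∈ univ.filter (fun j => (κ ^ 5) j = j), H x y = 1 ∨ H x y = -1 := fun x y _ => hH.1 x y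
    have h4 := four_dvd_card_of_three_orth (univ.filter fun j => (κ ^ 5) j = j) (H x₁) (H x₂) (H x₃)
      (hpm x₁) (hpm x₂) (hpm x₃) (hS x₁ x₂ h12 hx₁ hx₂) (hS x₁ x₃ h13 hx₁ hx₃) (hS x₂ x₃ h23 hx₂ hx₃)
    rw [h18] at h4
    obtain ⟨c, hc⟩ := h4
    omega
  · exact h68

/-- **An automorphism of order 25 of an H(668): the 5th powers fix exactly 68 rows and 68 columns.**  For a signed
automorphism `(π, κ, d, e)` with `π^25 = κ^25 = 1` and `(π⁵, κ⁵) ≠ (1, 1)`.  Structure only. -/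
theorem hadamard668_order25_pow5_fixed (hH : IsHadamardMatrix H) (hι : Fintype.card ι = 668)
    (π κ : Equiv.Perm ι) (d e : ι → ℤ) (haut : IsSignedAut H π κ d e)
    (hπ : π ^ 25 = 1) (hκ : κ ^ 25 = 1) (hne : π ^ 5 ≠ 1 ∨ κ ^ 5 ≠ 1) :
    (univ.filter fun i => (π ^ 5) i = i).card = 68 ∧ (univ.filter fun j => (κ ^ 5) j = j).card = 68 := by
  have hcard : (Fintype.card ι : ℤ) ≠ 0 := by rw [hι]; norm_num
  exact ⟨order25_pow5_cols (isHadamard_transpose hH hcard) hι (isSignedAut_transpose haut) hκ hπ hne.symm,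
    order25_pow5_cols hH hι haut hπ hκ hne⟩

end main

end Summit.Ventures.DiscreteObjects.Hadamard
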